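import Literature.MathematicalPhysics.QuantumFieldTheory.Balaban1983to89.Node00.N24Thm1Stage13RebindXWithB8PinB10Y0ZW0ChiSepCoPH
import Literature.MathematicalPhysics.QuantumFieldTheory.Balaban1983to89.Node00.Record13SClassSepCoPHChiCmap
import Summits.QuantumFields.YangMills.Theorems.BalabanUVNodesN24K1R9ByNameOfOpenStubsChildrenSplitSlot8Thm1AEAtAbstractWitnessY0
import Summits.QuantumFields.YangMills.Theorems.BalabanUVNodesN13Cor3AEKeepZeroOfEnginesRowAtRecord13Chi

/-!
# BalabanUVNodes ∕ K1ᴬ — THE χ-GENERIC EDITION OF THE ABSTRACT-WITNESS `Y₀` ENGINE, §1: the POINTED THEOREM-1 DOOR at an abstract witness with a free [B9] bundle, the record's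
# β-slot small-field function a FIXED parameter `(χ : ChiSlot F N)` — the general-`N` core of the K1 engine of record (`…AtAbstractWitnessY0` §1, ed.2 ✓p781642) re-issued so that
# the K1ᴬ engine can run at the RE-CENTRED cut-off `χ := chiβOfRecord₁₃Ax F N θ.toStage13Params` (WORK ORDER RC-1, director-ym №462 (B) ∕ №467 (D); K1ᴬ stmt-QuantumFields-27239)

TRACK A (YM-PLAN §2d), node N24 (binder B2, COMPOSITE), seat `pub-ymgap-dag-n24-c` g23 (op 5b ENGINE-LANE HAND, dag-lead HANDS I.21531 ∕ WORDS 581; `--kind proof --supports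
stmt-QuantumFields-27239 --as helper`, count-neutral).

WHAT.  The parent `…AtAbstractWitnessY0` §1 `N24_thm1R13SepCoPH_worldBuiltG_childrenSplitSlot8_psFloor_atWitness_pinY₀_pointed` — guard ∧ admissible ∧ `B16.Thm1Printed (datum).C` ∧ window from the
four door rows, `0 < θ.γ` + the upper box, N05 (`Slot8`), N06 (`B9LeafX Y₀`), N07–N10 (+ `h09T`), N11's `h11`, NODE O's PS floor — VERBATIM under the χ token map: provisos
`θ.Provisos₁₃SepCoPHChi F N χ`, datum `datumOfRecord₁₃SepCoPHChi F N θ χ hP`, β of record `betaOfRecord₁₃Chi F N θ.toStage13Params χ` (= the datum's `βfun`, `rfl`), laws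
`TLaw₁₃CoPHChi ∕ SLaw₁₃CoPHChi F N θ χ`, slots guard `θ.SlotsNondegenerate₁₃Chi F N χ`, Stage-5 view `toStage5₁₃CoPHChi F N χ`.  Callee changes (everything else cited BY NAME unchanged):
the eleven nodes + 𝐑-leaf from this seat's χ glue `Node00.N24_nodes11_rOperation₁₃SepCoPHChi_rebindX_withB8_pinB10Y₀ZW₀_pointed_chi` (`N24Thm1Stage13RebindXWithB8PinB10Y0ZW0ChiSepCoPH`);
the located flow step by dag-n07-w3's CLASS-FREE `K1RunwiseLettersOfBoxH.flowStepPrinted_leavesP_of_runLetters` at `CurriesHBeta` from `w.C = D.C`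
(`K1RunwiseLettersOfBoxHAtRecord.curriesHBeta_world_of_construction_eq`) and the guarded (0.20) door of this seat's `Node00.rgFlow_of_smallCouplings_of_C_eq_datumOfRecord₁₃SepCoPHChi`
(✓p808852 §0) — so NO record class (`IsRecordOfRecord₁₃CSepCoPHG`) is read at χ; N12-, N13-free as the parent.

WHAT IS HERE (theorems only; 0 `def`, 0 `sorry`, standard axioms):
* §1χ ★ `N24_thm1R13SepCoPHChi_worldBuilt_childrenSplitSlot8_psFloor_atWitness_pinY₀_pointed_chi` (general `N`, any `χ`).
* §1Ax `N24_thm1R13SepCoPHAx_worldBuilt_childrenSplitSlot8_psFloor_atWitness_pinY₀_pointed` — the instance at `χ := chiβOfRecord₁₃Ax F N θ.toStage13Params` in the Ax vocabulary of the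
  K-Ax re-cuts (`Provisos₁₃SepCoPHAx`, `datumOfRecord₁₃SepCoPHAx`, `betaOfRecord₁₃Ax`, `SlotsNondegenerate₁₃Ax`; one line, all `rfl`-abbrevs of `[Ax-3a∕3c∕3d]`).
* §2Ax ★★★ `N24_stabilityBRunRowsR13SepCoPHVAx_consequent_childrenSplitSlot8Thm1AE_atWitness_pinY₀_of_runRowsCont` (`N = 2`, per `F`): K1ᴬ's θ-keyed consequent at an abstract admissible witness
  from §1Ax + N13 in the a.e. currency through this seat's `N13Cor3AEKeepZeroOfEnginesRowAtRecord13Chi.exists_revision₁₃Ax_endStatementBPrinted_of_thm1_of_row0_of_aeRowSucc` + NODE O's run rows.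
* §3Ax ★★★★ `N24_stabilityBRunRowsAtRecordR13SepCoPHVAx_byName_of_abstractWitnessFamily_childrenSplitSlot8Thm1AE_pinY₀_of_runRowsCont` — K1ᴬ `StabilityBRunRowsAtRecordR13SepCoPHVAx` BY ITS
  ROUTE NAME from an abstract witness family (antecedent = K0ᴬ's body); CONDITIONAL on every displayed family (audit `proof.conditional`), credits nothing.

HONEST SCOPE ∕ A6.  Implications only; every node's printed content is a DISPLAYED hypothesis (`h05 … h11`, `hlaws`, `hbox'`, `hps`), inhabited at NO θ here; nothing of Bałaban asserted;
K1ᴬ NOT closed (DECIDING ∕ OPEN); no registered stub closed; N24 COMPOSITE — no discharge, no count claim (discharged 8∕27 · K 1∕4 unmoved).  One finite 𝕋⁴ programme at fixed ε, Bałaban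
AS PRINTED; R4 closes ONLY the conditional finite-𝕋⁴ rung `BalabanLadder.UV` — the YM mass gap (Clay) is NOT proved by any of this; nothing continuum ∕ ℝ⁴ ∕ OS.  Theorems only: no `def`,
no `instance`, no `sorry`.  References (context; nothing printed is used as a hypothesis): [V] = [Balaban1989LargeFieldII] Thm 1 p.355, (0.1) pp.355–356, p.387, p.391; [III] =
[Balaban1988Convergent] (0.2) p.244, (2.18) p.257, Thm 2 p.263; [I] = [Balaban1987RG1] Thm 3 p.264, (1.20)–(1.22) p.264, §1 pp.263–264, (0.17)–(0.20) pp.255–256, (2.9) p.266 with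
(2.3) p.265; [Balaban1985RegularSpaces] Prop. 7 (1.145) p.100, Thm 8 (1.146) p.101; [Balaban1985BackgroundPropagators] Thm 3.1 p.397; [Balaban1988RG2Cluster] Lemmas 1–3 pp.9–20,
(2.5)∕(2.9) (the re-centred cut-off).
-/

noncomputable section

open scoped Matrix.Norms.L2Operator BigOperators
open Filter Topology MeasureTheory

namespace Summit.QuantumFields.YangMills.BalabanUVNodes.N24K1R9ByNameOfOpenStubsChildrenSplitSlot8Thm1AEAtAbstractWitnessY0Chi

open Literature.MathematicalPhysics.QuantumFieldTheory.Balaban1983to89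
open Literature.MathematicalPhysics.QuantumFieldTheory.Balaban1983to89.Node00
open DagBinding T4Continuum T4DatumAssembly FlowStepRuns AveragingRT
open FlowStep (HBeta RGEqH prefixOf prefixOf_apply BetaLowerH BetaUpperH Box mem_box clampPrefix Y)
open Summit.QuantumFields.YangMills.BalabanUVNodes.N12AtRecord12Pointed (exists_printedCarriers15_b15Leaf)
open Summit.QuantumFields.YangMills.Theorems.K1RunwiseLettersOfBoxH (runCeiling_of_betaUpperH exists_frequently_betaZero_le_of_runCeiling flowStepPrinted_leavesP_of_runLetters)
open Summit.QuantumFields.YangMills.Theorems.K1RunwiseLettersOfBoxHAtRecord (curriesHBeta_world_of_construction_eq)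
open Summit.QuantumFields.YangMills.Theorems.BalabanUVNodesK1WindowExactCriterion (window_of_frequently_beta_le)
open Summit.QuantumFields.YangMills.Theorems.K1NodeOLadderRunwiseEdges (exists_noShrink_of_psFloor)
open Summit.QuantumFields.YangMills.BalabanUVNodes.N13Cor3AEKeepZeroOfEnginesRowAtRecord13Chi (exists_revision₁₃Ax_endStatementBPrinted_of_thm1_of_row0_of_aeRowSucc)

variable {F : T4Family} {N : ℕ} [NeZero N]

/-! ## §1χ. General `N`, any χ: THE POINTED THEOREM-1 DOOR AT AN ABSTRACT WITNESS WITH A FREE [B9] BUNDLE `Y₀` (N05 at `Slot8`, N06 ← `B9LeafX Y₀`, N07–N11, NODE O's PS floor; N12- and N13-free) -/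

/-- **THE POINTED THEOREM-1 DOOR AT AN ABSTRACT WITNESS, [B9] BUNDLE FREE, χ-GENERIC** — the parent's §1 with the record's β-slot cut-off a fixed parameter `χ`: guard ∧ admissible ∧
`B16.Thm1Printed (datumOfRecord₁₃SepCoPHChi F N θ χ hP).C` ∧ window, from the four door rows, `0 < θ.γ` + upper box on `betaOfRecord₁₃Chi θ χ`, N05 (`Slot8`), N06 (`Y₀`), N07–N10 (+ `h09T`),
N11's `h11` over `SLaw₁₃CoPHChi ∕ TLaw₁₃CoPHChi`, NODE O's PS floor; world pinned at `pinY Y₀`, eleven nodes by this seat's χ glue, flow step by dag-n07-w3's class-free run-letter road, guarded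
(0.20) by the class-free datum door.  CONDITIONAL; nothing of Bałaban asserted.
[cite: Balaban1989LargeFieldII, Thm 1 p.355, (0.1) pp.355–356, p.387, p.391; Balaban1988Convergent, (0.2) p.244, Thm 2 p.263; Balaban1987RG1, Thm 3 p.264, (1.20)–(1.22) p.264, §1 pp.263–264, (0.17)–(0.20) pp.255–256, (2.9) p.266; Balaban1985RegularSpaces, Prop. 7 (1.145) p.100, Thm 8 (1.146) p.101; Balaban1985BackgroundPropagators, Thm 3.1 p.397; Balaban1988RG2Cluster, Lemmas 1–3 pp.9–20 (bookkeeping)] -/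
theorem N24_thm1R13SepCoPHChi_worldBuilt_childrenSplitSlot8_psFloor_atWitness_pinY₀_pointed_chi (Slot8 : (θ₃ : Stage3Params) → ResidB8 θ₃ → Prop) (θ : Stage13HParams F N)
    (χ : ChiSlot F N) (hP : θ.Provisos₁₃SepCoPHChi F N χ) (hθ : θ.Admissible F N) (hU : θ.ZhUnity F N ∧ θ.SlotsNondegenerate₁₃Chi F N χ)
    (hlaws : ∀ (P : B12.RunParams) (k : ℕ), k < P.K → TLaw₁₃CoPHChi F N θ χ P k → SLaw₁₃CoPHChi F N θ χ P (k + 1))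
    {β' : ℝ} (hγ₀ : 0 < θ.γ) (hbox' : BetaUpperH β' θ.γ (betaOfRecord₁₃Chi F N θ.toStage13Params χ))
    (h05 : ∃ lam8 : ResidB8 θ.toStage13Params.toStage3Params, Slot8 θ.toStage13Params.toStage3Params lam8)
    (Y₀ : PrintedCarriers9X) (h06 : B9LeafX Y₀)
    (h07 : ∃ ζ : ResidZ F N, B11Leaf (Z11OfRecord F N ζ))
    (h08 : PrintedUV3V N θ.L)
    (h09 : ∃ lam12 : ResidB12 F N θ.toStage13Params.τ9.M,
      ∀ P : B12.RunParams, B12Sec2to5.Lemma4Printed (F12OfRecord₁₂ F N θ.toStage13Params.toStage12Params lam12 P) (lam12 P).consts)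
    (h09T : ∃ γ₉ : ℝ, 0 < γ₉ ∧ ∀ w : WorldP, w.C = (datumOfRecord₁₃SepCoPHChi F N θ χ hP).C →
      w.γ ≤ γ₉ → ∀ P : B12.RunParams, (leavesP w P).smallCouplings → (leavesP w P).smallFieldInductive)
    (h10 : ∃ lam13 : B12.RunParams → ResidB13 θ.toStage13Params.toStage3Params,
      ∀ P : B12.RunParams, B13LeafOfRecord θ.toStage13Params.toStage3Params (lam13 P))
    (h11 : ∀ βup β₀ : ℝ, ∃ γ₁₁ : ℝ, 0 < γ₁₁ ∧ ∀ w : WorldP, w.C = (datumOfRecord₁₃SepCoPHChi F N θ χ hP).C →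
      w.βup = βup → w.β₀ = β₀ → w.γ ≤ γ₁₁ → ∀ P : B12.RunParams, (leavesP w P).b7 → (leavesP w P).b8 → (leavesP w P).b9 → (leavesP w P).b10 → (leavesP w P).b11 →
      (leavesP w P).smallCouplings → (leavesP w P).smallFieldInductive → (leavesP w P).flowControl →
        ∀ k, k < P.K → SLaw₁₃CoPHChi F N θ χ P k → TLaw₁₃CoPHChi F N θ χ P k)
    {γR M : ℝ} (hγR : 0 < γR)
    (hps : ∀ (n : ℕ) (gs : ℕ → ℝ), RGEqH n (betaOfRecord₁₃Chi F N θ.toStage13Params χ) gs → Step.InInterval γR n gs →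
      ∀ k, k ≤ n → -M ≤ ∑ j ∈ Finset.Ico k n, betaOfRecord₁₃Chi F N θ.toStage13Params χ j (prefixOf gs j)) :
    (θ.ZhUnity F N ∧ θ.SlotsNondegenerate₁₃Chi F N χ) ∧ θ.Admissible F N ∧
      B16.Thm1Printed (datumOfRecord₁₃SepCoPHChi F N θ χ hP).C ∧
      ∃ γ₁ : ℝ, 0 < γ₁ ∧ ∀ γ' : ℝ, 0 < γ' → γ' ≤ γ₁ → ∃ P : B12.RunParams, 1 ≤ P.K ∧ ((datumOfRecord₁₃SepCoPHChi F N θ χ hP).C P).flow.InInterval γ' P.K := by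
  obtain ⟨lam8, h05⟩ := h05
  obtain ⟨ζ, h07⟩ := h07
  obtain ⟨lam12, h09⟩ := h09
  obtain ⟨lam13, h10⟩ := h10
  obtain ⟨γ₉, hγ₉, h09T⟩ := h09T
  obtain ⟨γ₁₁, hγ₁₁, h11⟩ := h11 β' 1
  obtain ⟨γ', hγ', -, hns⟩ := exists_noShrink_of_psFloor one_pos hγR hps
  have hL1 : (1 : ℝ) < (θ.toStage13Params.L : ℝ) := by exact_mod_cast θ.toStage13Params.hL.2
  have hγw0 : 0 < min θ.γ (min γ₉ (min γ₁₁ γ')) := lt_min hγ₀ (lt_min hγ₉ (lt_min hγ₁₁ hγ'))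
  have hγwγ : min θ.γ (min γ₉ (min γ₁₁ γ')) ≤ θ.γ := min_le_left _ _
  have hγw9 : min θ.γ (min γ₉ (min γ₁₁ γ')) ≤ γ₉ := (min_le_right _ _).trans (min_le_left _ _)
  have hγw11 : min θ.γ (min γ₉ (min γ₁₁ γ')) ≤ γ₁₁ := (min_le_right _ _).trans ((min_le_right _ _).trans (min_le_left _ _))
  have hγw13 : min θ.γ (min γ₉ (min γ₁₁ γ')) ≤ γ' := (min_le_right _ _).trans ((min_le_right _ _).trans (min_le_right _ _))
  set γw : ℝ := min θ.γ (min γ₉ (min γ₁₁ γ'))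
  let w : WorldP :=
    { C := (datumOfRecord₁₃SepCoPHChi F N θ χ hP).C
      γ := γw, em := fun _ => 0, ep := fun _ => 0, βup := β', β₀ := 1, β₀_pos := one_pos, b := 1, b_pos := one_pos
      L := (θ.toStage13Params.L : ℝ), one_lt_L := hL1, gR := 0
      up := fun P => (upOfRecord₅C F N ((((((θ.rebindX F N (fun P : B12.RunParams => (((θ.toStage13Params.res.X P).withB12 (F12OfRecord₁₂ F N θ.toStage13Params.toStage12Params lam12 P) (lam12 P).consts).withB13OfRecord θ.toStage13Params.toStage3Params (lam13 P)))).toStage5₁₃CoPHChi F N χ).pinB10 F N).pinY F N (Y₀)).pinZ F N (Z11OfRecord F N ζ)).pinW F N (fun P : B12.RunParams => (exists_printedCarriers15_b15Leaf (F.P P.K)).choose)) P).withB8 (Slot8 θ.toStage13Params.toStage3Params lam8) }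
  have hC : w.C = (datumOfRecord₁₃SepCoPHChi F N θ χ hP).C := rfl
  have hnodes := N24_nodes11_rOperation₁₃SepCoPHChi_rebindX_withB8_pinB10Y₀ZW₀_pointed_chi θ χ hP hθ
    (fun P : B12.RunParams => (((θ.toStage13Params.res.X P).withB12 (F12OfRecord₁₂ F N θ.toStage13Params.toStage12Params lam12 P) (lam12 P).consts).withB13OfRecord θ.toStage13Params.toStage3Params (lam13 P))) Y₀ ζ
    (fun P : B12.RunParams => (exists_printedCarriers15_b15Leaf (F.P P.K)).choose) (fun _ => Slot8 θ.toStage13Params.toStage3Params lam8) w hC ⟨hγw0, hγwγ⟩ rfl (fun P => rfl)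
    (fun P => h05) h06 h07 h08 (fun P => h09 P) (h09T w hC hγw9) (fun P _ _ _ _ => h10 P) (h11 w hC rfl rfl hγw11) hlaws
  have hceil := runCeiling_of_betaUpperH hbox' (min_le_left θ.γ γ')
  have hcur : CurriesHBeta w.C.toB12 (datumOfRecord₁₃SepCoPHChi F N θ χ hP).βfun := curriesHBeta_world_of_construction_eq hC
  have hflow : ∀ P : B12.RunParams, Dag.FlowStepPrinted (leavesP w P) := fun P =>
    flowStepPrinted_leavesP_of_runLetters w hcur P (rgFlow_of_smallCouplings_of_C_eq_datumOfRecord₁₃SepCoPHChi F N θ χ hP w hC P)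
      (le_min hγwγ hγw13) hceil
      (fun n gs hrg hI m n' hmn hn' => hns n gs hrg (fun k hk => ⟨(hI k hk).1, (hI k hk).2.trans (min_le_right θ.γ γ')⟩) m n' hmn hn')
  have h1 : B16.Thm1Printed w.C := thm1Printed_of_nodes11_of_rOperation w hγw0 (fun P => (hnodes P).1) (fun P => (hnodes P).2) hflow
  refine ⟨hU, hθ, ?_, window_of_frequently_beta_le _ (exists_frequently_betaZero_le_of_runCeiling (lt_min hγ₀ hγ') hceil)⟩
  rw [← hC]
  exact h1

/-! ## §1Ax. The instance at the RE-CENTRED cut-off `χ := chiβOfRecord₁₃Ax F N θ.toStage13Params` in the K-Ax vocabulary -/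

/-- **THE POINTED THEOREM-1 DOOR AT AN ABSTRACT WITNESS, [B9] BUNDLE FREE, AT THE RE-CENTRED RECORD** (Ax): §1χ at `χ := chiβOfRecord₁₃Ax F N θ.toStage13Params`, stated in the K-Ax re-cuts'
vocabulary — `θ.Provisos₁₃SepCoPHAx F N`, `θ.SlotsNondegenerate₁₃Ax F N`, `datumOfRecord₁₃SepCoPHAx F N θ hP`, `betaOfRecord₁₃Ax F N θ.toStage13Params` (all `rfl`-abbrevs of the χ-generic
objects, `[Ax-3a∕3c∕3d]`); the laws stay spelled `…CoPHChi … (chiβOfRecord₁₃Ax …)` (no law abbrev exists).  CONDITIONAL; nothing of Bałaban asserted; K1ᴬ NOT closed.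
[cite: Balaban1989LargeFieldII, Thm 1 p.355, (0.1) pp.355–356, p.391; Balaban1987RG1, (2.9) p.266 with (2.3) p.265, Thm 3 p.264; Balaban1988RG2Cluster, (2.5)∕(2.9) (bookkeeping)] -/
theorem N24_thm1R13SepCoPHAx_worldBuilt_childrenSplitSlot8_psFloor_atWitness_pinY₀_pointed (Slot8 : (θ₃ : Stage3Params) → ResidB8 θ₃ → Prop) (θ : Stage13HParams F N)
    (hP : θ.Provisos₁₃SepCoPHAx F N) (hθ : θ.Admissible F N) (hU : θ.ZhUnity F N ∧ θ.SlotsNondegenerate₁₃Ax F N)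
    (hlaws : ∀ (P : B12.RunParams) (k : ℕ), k < P.K → TLaw₁₃CoPHChi F N θ (chiβOfRecord₁₃Ax F N θ.toStage13Params) P k →
      SLaw₁₃CoPHChi F N θ (chiβOfRecord₁₃Ax F N θ.toStage13Params) P (k + 1))
    {β' : ℝ} (hγ₀ : 0 < θ.γ) (hbox' : BetaUpperH β' θ.γ (betaOfRecord₁₃Ax F N θ.toStage13Params))
    (h05 : ∃ lam8 : ResidB8 θ.toStage13Params.toStage3Params, Slot8 θ.toStage13Params.toStage3Params lam8)
    (Y₀ : PrintedCarriers9X) (h06 : B9LeafX Y₀)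
    (h07 : ∃ ζ : ResidZ F N, B11Leaf (Z11OfRecord F N ζ))
    (h08 : PrintedUV3V N θ.L)
    (h09 : ∃ lam12 : ResidB12 F N θ.toStage13Params.τ9.M,
      ∀ P : B12.RunParams, B12Sec2to5.Lemma4Printed (F12OfRecord₁₂ F N θ.toStage13Params.toStage12Params lam12 P) (lam12 P).consts)
    (h09T : ∃ γ₉ : ℝ, 0 < γ₉ ∧ ∀ w : WorldP, w.C = (datumOfRecord₁₃SepCoPHAx F N θ hP).C →
      w.γ ≤ γ₉ → ∀ P : B12.RunParams, (leavesP w P).smallCouplings → (leavesP w P).smallFieldInductive)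
    (h10 : ∃ lam13 : B12.RunParams → ResidB13 θ.toStage13Params.toStage3Params,
      ∀ P : B12.RunParams, B13LeafOfRecord θ.toStage13Params.toStage3Params (lam13 P))
    (h11 : ∀ βup β₀ : ℝ, ∃ γ₁₁ : ℝ, 0 < γ₁₁ ∧ ∀ w : WorldP, w.C = (datumOfRecord₁₃SepCoPHAx F N θ hP).C →
      w.βup = βup → w.β₀ = β₀ → w.γ ≤ γ₁₁ → ∀ P : B12.RunParams, (leavesP w P).b7 → (leavesP w P).b8 → (leavesP w P).b9 → (leavesP w P).b10 → (leavesP w P).b11 →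
      (leavesP w P).smallCouplings → (leavesP w P).smallFieldInductive → (leavesP w P).flowControl →
        ∀ k, k < P.K → SLaw₁₃CoPHChi F N θ (chiβOfRecord₁₃Ax F N θ.toStage13Params) P k → TLaw₁₃CoPHChi F N θ (chiβOfRecord₁₃Ax F N θ.toStage13Params) P k)
    {γR M : ℝ} (hγR : 0 < γR)
    (hps : ∀ (n : ℕ) (gs : ℕ → ℝ), RGEqH n (betaOfRecord₁₃Ax F N θ.toStage13Params) gs → Step.InInterval γR n gs →
      ∀ k, k ≤ n → -M ≤ ∑ j ∈ Finset.Ico k n, betaOfRecord₁₃Ax F N θ.toStage13Params j (prefixOf gs j)) :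
    (θ.ZhUnity F N ∧ θ.SlotsNondegenerate₁₃Ax F N) ∧ θ.Admissible F N ∧
      B16.Thm1Printed (datumOfRecord₁₃SepCoPHAx F N θ hP).C ∧
      ∃ γ₁ : ℝ, 0 < γ₁ ∧ ∀ γ' : ℝ, 0 < γ' → γ' ≤ γ₁ → ∃ P : B12.RunParams, 1 ≤ P.K ∧ ((datumOfRecord₁₃SepCoPHAx F N θ hP).C P).flow.InInterval γ' P.K :=
  N24_thm1R13SepCoPHChi_worldBuilt_childrenSplitSlot8_psFloor_atWitness_pinY₀_pointed_chi Slot8 θ (chiβOfRecord₁₃Ax F N θ.toStage13Params) hP hθ hU hlaws hγ₀ hbox'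
    h05 Y₀ h06 h07 h08 h09 h09T h10 h11 hγR hps

/-! ## §2Ax. `N = 2`, per `F`: K1ᴬ's consequent at an abstract witness with a free [B9] bundle (N13 in the a.e. currency at `θ`), RE-CENTRED record -/

/-- **★★★ K1ᴬ's θ-KEYED CONSEQUENT AT `F` AT AN ABSTRACT ADMISSIBLE WITNESS WITH A FREE [B9] BUNDLE `Y₀`, RE-CENTRED RECORD** — the parent's §2 under σ (Ax vocabulary; §1Ax above; N13 through this seat's `exists_revision₁₃Ax_endStatementBPrinted_of_thm1_of_row0_of_aeRowSucc`): the four door rows, `0 < θ.γ` + upper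
box, children at `θ` (N05 at `Slot8`, N06 at `Y₀`, N07–N11), N13 a.e. rows, NODE O run rows ⊢ K1ᴬ's body at `F`.  CONDITIONAL; N13 NOT discharged; K1ᴬ NOT closed.
[cite: Balaban1989LargeFieldII, Thm 1 p.355, (0.1) pp.355–356, p.391; Balaban1988Convergent, Cor. 3 (2.50) p.264, (0.2) p.244, (2.6) p.255; Balaban1987RG1, Thm 3 p.264, (1.20)–(1.22) p.264, §1 pp.263–264, (0.17)–(0.20) pp.255–256; Balaban1985RegularSpaces, Prop. 7 (1.145) p.100, Thm 8 (1.146) p.101 (bookkeeping)] -/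
theorem N24_stabilityBRunRowsR13SepCoPHVAx_consequent_childrenSplitSlot8Thm1AE_atWitness_pinY₀_of_runRowsCont (Slot8 : (θ₃ : Stage3Params) → ResidB8 θ₃ → Prop) (θ : Stage13HParams F 2)
    (hP : θ.Provisos₁₃SepCoPHAx F 2) (hθ : θ.Admissible F 2) (hU : θ.ZhUnity F 2 ∧ θ.SlotsNondegenerate₁₃Ax F 2)
    (hlaws : ∀ (P : B12.RunParams) (k : ℕ), k < P.K → TLaw₁₃CoPHChi F 2 θ (chiβOfRecord₁₃Ax F 2 θ.toStage13Params) P k → SLaw₁₃CoPHChi F 2 θ (chiβOfRecord₁₃Ax F 2 θ.toStage13Params) P (k + 1))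
    {β' : ℝ} (hγ₀ : 0 < θ.γ) (hbox' : BetaUpperH β' θ.γ (betaOfRecord₁₃Ax F 2 θ.toStage13Params))
    (h05 : ∃ lam8 : ResidB8 θ.toStage13Params.toStage3Params, Slot8 θ.toStage13Params.toStage3Params lam8)
    (Y₀ : PrintedCarriers9X) (h06 : B9LeafX Y₀)
    (h07 : ∃ ζ : ResidZ F 2, B11Leaf (Z11OfRecord F 2 ζ))
    (h08 : PrintedUV3V 2 θ.L)
    (h09 : ∃ lam12 : ResidB12 F 2 θ.toStage13Params.τ9.M,
      ∀ P : B12.RunParams, B12Sec2to5.Lemma4Printed (F12OfRecord₁₂ F 2 θ.toStage13Params.toStage12Params lam12 P) (lam12 P).consts)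
    (h09T : ∃ γ₉ : ℝ, 0 < γ₉ ∧ ∀ w : WorldP, w.C = (datumOfRecord₁₃SepCoPHAx F 2 θ hP).C →
      w.γ ≤ γ₉ → ∀ P : B12.RunParams, (leavesP w P).smallCouplings → (leavesP w P).smallFieldInductive)
    (h10 : ∃ lam13 : B12.RunParams → ResidB13 θ.toStage13Params.toStage3Params,
      ∀ P : B12.RunParams, B13LeafOfRecord θ.toStage13Params.toStage3Params (lam13 P))
    (h11 : ∀ βup β₀ : ℝ, ∃ γ₁₁ : ℝ, 0 < γ₁₁ ∧ ∀ w : WorldP, w.C = (datumOfRecord₁₃SepCoPHAx F 2 θ hP).C →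
      w.βup = βup → w.β₀ = β₀ → w.γ ≤ γ₁₁ → ∀ P : B12.RunParams, (leavesP w P).b7 → (leavesP w P).b8 → (leavesP w P).b9 → (leavesP w P).b10 → (leavesP w P).b11 →
      (leavesP w P).smallCouplings → (leavesP w P).smallFieldInductive → (leavesP w P).flowControl →
        ∀ k, k < P.K → SLaw₁₃CoPHChi F 2 θ (chiβOfRecord₁₃Ax F 2 θ.toStage13Params) P k → TLaw₁₃CoPHChi F 2 θ (chiβOfRecord₁₃Ax F 2 θ.toStage13Params) P k)
    (h13 : ∃ γ₁₃ : ℝ, 0 < γ₁₃ ∧ ∃ em ep : ℝ → ℝ,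
        (∀ P : B12.RunParams, ((datumOfRecord₁₃SepCoPHAx F 2 θ hP).C P).flow.InInterval γ₁₃ P.K → SLaw₁₃CoPHChi F 2 θ (chiβOfRecord₁₃Ax F 2 θ.toStage13Params) P 0 →
      ∀ U : GaugeField (F.P P.K) 0 (SU 2),
        chiβOfRecord₁₃Ax F 2 θ.toStage13Params P.K (gOfRecord₁₃Ax F 2 θ.toStage13Params P) 0 U *
              Real.exp (-(1 / (gOfRecord₁₃Ax F 2 θ.toStage13Params P 0) ^ 2 * wilsonBGOfRecord F 2 θ.εbg P 0 U)
                - em (gOfRecord₁₃Ax F 2 θ.toStage13Params P 0) * (Fintype.card (Site (F.P P.K) 0) : ℝ)) ≤ densOfRecord₁₃Chi F 2 θ.toStage13Params (chiβOfRecord₁₃Ax F 2 θ.toStage13Params) P 0 U ∧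
          densOfRecord₁₃Chi F 2 θ.toStage13Params (chiβOfRecord₁₃Ax F 2 θ.toStage13Params) P 0 U ≤ Real.exp (ep (gOfRecord₁₃Ax F 2 θ.toStage13Params P 0) * (Fintype.card (Site (F.P P.K) 0) : ℝ))) ∧
        (∀ P : B12.RunParams, ((datumOfRecord₁₃SepCoPHAx F 2 θ hP).C P).flow.InInterval γ₁₃ P.K → ∀ k, k + 1 ≤ P.K → SLaw₁₃CoPHChi F 2 θ (chiβOfRecord₁₃Ax F 2 θ.toStage13Params) P (k + 1) →
      ∀ᵐ U ∂(fieldMeasure (F.P P.K) (k + 1) (SU 2)),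
        chiβOfRecord₁₃Ax F 2 θ.toStage13Params P.K (gOfRecord₁₃Ax F 2 θ.toStage13Params P) (k + 1) U *
              Real.exp (-(1 / (gOfRecord₁₃Ax F 2 θ.toStage13Params P (k + 1)) ^ 2 * wilsonBGOfRecord F 2 θ.εbg P (k + 1) U)
                - em (gOfRecord₁₃Ax F 2 θ.toStage13Params P (k + 1)) * (Fintype.card (Site (F.P P.K) (k + 1)) : ℝ)) ≤ densOfRecord₁₃Chi F 2 θ.toStage13Params (chiβOfRecord₁₃Ax F 2 θ.toStage13Params) P (k + 1) U ∧
          densOfRecord₁₃Chi F 2 θ.toStage13Params (chiβOfRecord₁₃Ax F 2 θ.toStage13Params) P (k + 1) U ≤ Real.exp (ep (gOfRecord₁₃Ax F 2 θ.toStage13Params P (k + 1)) * (Fintype.card (Site (F.P P.K) (k + 1)) : ℝ))))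
    (hrowsR : ∃ (b : ℕ → ℝ) (r γ₀ M : ℝ), 0 < γ₀ ∧
        (∀ (n : ℕ) (gs : ℕ → ℝ), RGEqH n (betaOfRecord₁₃Ax F 2 θ.toStage13Params) gs → Step.InInterval γ₀ n gs → ∀ k, k ≤ n → |betaOfRecord₁₃Ax F 2 θ.toStage13Params k (prefixOf gs k) - b k| ≤ r) ∧
        (∀ (n : ℕ) (gs : ℕ → ℝ), RGEqH n (betaOfRecord₁₃Ax F 2 θ.toStage13Params) gs → Step.InInterval γ₀ n gs → ∀ k, k ≤ n → -M ≤ ∑ j ∈ Finset.Ico k n, betaOfRecord₁₃Ax F 2 θ.toStage13Params j (prefixOf gs j)) ∧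
        ∀ k : ℕ, ContinuousOn (fun x : ℝ => betaOfRecord₁₃Ax F 2 θ.toStage13Params k (clampPrefix (betaOfRecord₁₃Ax F 2 θ.toStage13Params) γ₀ k x))
          {x : ℝ | 0 < x ∧ x ≤ γ₀ ∧ ∀ j', j' ≤ k → 1 / γ₀ ^ 2 ≤ Y (betaOfRecord₁₃Ax F 2 θ.toStage13Params) γ₀ j' x}) :
    ∃ (θ' : Stage13HParams F 2) (h' : θ'.Provisos₁₃SepCoPHAx F 2) (v' : Revision₁₃Ax F 2 θ' h'), (θ'.ZhUnity F 2 ∧ θ'.SlotsNondegenerate₁₃Ax F 2) ∧ θ'.Admissible F 2 ∧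
      B16.EndStatementBPrinted (datumOfRecord₁₃SepCoPHVAx F 2 θ' h' v').C ∧
      (∃ γ₁ : ℝ, 0 < γ₁ ∧ ∀ γ : ℝ, 0 < γ → γ ≤ γ₁ → ∃ P : B12.RunParams, 1 ≤ P.K ∧ ((datumOfRecord₁₃SepCoPHVAx F 2 θ' h' v').C P).flow.InInterval γ P.K) ∧
      ∃ (b : ℕ → ℝ) (r γ₀ M : ℝ), 0 < γ₀ ∧
        (∀ (n : ℕ) (gs : ℕ → ℝ), RGEqH n (betaOfRecord₁₃Ax F 2 θ'.toStage13Params) gs → Step.InInterval γ₀ n gs → ∀ k, k ≤ n → |betaOfRecord₁₃Ax F 2 θ'.toStage13Params k (prefixOf gs k) - b k| ≤ r) ∧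
        (∀ (n : ℕ) (gs : ℕ → ℝ), RGEqH n (betaOfRecord₁₃Ax F 2 θ'.toStage13Params) gs → Step.InInterval γ₀ n gs → ∀ k, k ≤ n → -M ≤ ∑ j ∈ Finset.Ico k n, betaOfRecord₁₃Ax F 2 θ'.toStage13Params j (prefixOf gs j)) ∧
        ∀ k : ℕ, ContinuousOn (fun x : ℝ => betaOfRecord₁₃Ax F 2 θ'.toStage13Params k (clampPrefix (betaOfRecord₁₃Ax F 2 θ'.toStage13Params) γ₀ k x))
          {x : ℝ | 0 < x ∧ x ≤ γ₀ ∧ ∀ j', j' ≤ k → 1 / γ₀ ^ 2 ≤ Y (betaOfRecord₁₃Ax F 2 θ'.toStage13Params) γ₀ j' x} := by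
  obtain ⟨b, r, γR, M, hγR, hrem, hps, hcont⟩ := hrowsR
  obtain ⟨hU', hθ', hT1, hwin⟩ := N24_thm1R13SepCoPHAx_worldBuilt_childrenSplitSlot8_psFloor_atWitness_pinY₀_pointed Slot8 θ hP hθ hU hlaws hγ₀ hbox'
    h05 Y₀ h06 h07 h08 h09 h09T h10 h11 hγR hps
  obtain ⟨γ₁₃, hγ₁₃, em, ep, h0, hae⟩ := h13
  obtain ⟨v, hB⟩ := exists_revision₁₃Ax_endStatementBPrinted_of_thm1_of_row0_of_aeRowSucc F 2 _ _ hT1 hγ₁₃ h0 hae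
  exact ⟨_, _, v, hU', hθ', hB, hwin, b, r, γR, M, hγR, hrem, hps, hcont⟩

/-! ## §3. ★★★★ K1ᴬ BY ITS ROUTE NAME FROM AN ABSTRACT WITNESS FAMILY WITH A [B9] BUNDLE FAMILY `Y₀ F i` -/

/-- **★★★★ K1ᴬ `StabilityBRunRowsAtRecordR13SepCoPHVAx` (stmt-QuantumFields-27239) BY ITS ROUTE NAME, DOOR-FREE, WITNESS-FREE AND [B9]-BUNDLE-FREE, RE-CENTRED RECORD** — the parent's §3 under σ with a bundle family
`Y₀ : ∀ F, ι F → PrintedCarriers9X` and `h06 : ∀ F i, B9LeafX (Y₀ F i)`; every concrete face (`Y9OfRecord … ops`, `Y9OfRecordP … ops`, any witness door) is ONE `exact` of this theorem.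
CONDITIONAL (every family displayed; audit `proof.conditional`); not a closure; no registered stub used or closed; no count moved; the antecedent `hK0` is K0ᴬ's body.
[cite: Balaban1989LargeFieldII, Thm 1 p.355, (0.1) pp.355–356, p.391; Balaban1988Convergent, Cor. 3 (2.50) p.264, (0.2) p.244; Balaban1987RG1, Thm 3 p.264, (1.20)–(1.22) p.264, §1 pp.263–264; Balaban1985RegularSpaces, Prop. 7 (1.145) p.100, Thm 8 (1.146) p.101; Balaban1985BackgroundPropagators, Thm 3.1 p.397 (bookkeeping)] -/
theorem N24_stabilityBRunRowsAtRecordR13SepCoPHVAx_byName_of_abstractWitnessFamily_childrenSplitSlot8Thm1AE_pinY₀_of_runRowsCont (Slot8 : (θ₃ : Stage3Params) → ResidB8 θ₃ → Prop)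
    (ι : T4Family → Type) (Θ : ∀ F : T4Family, ι F → Stage13HParams F 2) (hK0 : ∀ F : T4Family, (∃ θ : Stage13HParams F 2, θ.Provisos₁₃SepCoPHAx F 2 ∧ (θ.ZhUnity F 2 ∧ θ.SlotsNondegenerate₁₃Ax F 2) ∧ θ.Admissible F 2) → Nonempty (ι F))
    (hP : ∀ (F : T4Family) (i : ι F), (Θ F i).Provisos₁₃SepCoPHAx F 2) (hθ : ∀ (F : T4Family) (i : ι F), (Θ F i).Admissible F 2)
    (hU : ∀ (F : T4Family) (i : ι F), (Θ F i).ZhUnity F 2 ∧ (Θ F i).SlotsNondegenerate₁₃Ax F 2)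
    (hlaws : ∀ (F : T4Family) (i : ι F) (P : B12.RunParams) (k : ℕ), k < P.K → TLaw₁₃CoPHChi F 2 (Θ F i) (chiβOfRecord₁₃Ax F 2 (Θ F i).toStage13Params) P k → SLaw₁₃CoPHChi F 2 (Θ F i) (chiβOfRecord₁₃Ax F 2 (Θ F i).toStage13Params) P (k + 1))
    (βup : ∀ F : T4Family, ι F → ℝ) (hγ₀ : ∀ (F : T4Family) (i : ι F), 0 < (Θ F i).γ)
    (hbox' : ∀ (F : T4Family) (i : ι F), BetaUpperH (βup F i) (Θ F i).γ (betaOfRecord₁₃Ax F 2 (Θ F i).toStage13Params))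
    (h05 : ∀ (F : T4Family) (i : ι F), ∃ lam8 : ResidB8 (Θ F i).toStage13Params.toStage3Params, Slot8 (Θ F i).toStage13Params.toStage3Params lam8)
    (Y₀ : ∀ F : T4Family, ι F → PrintedCarriers9X) (h06 : ∀ (F : T4Family) (i : ι F), B9LeafX (Y₀ F i))
    (h07 : ∀ F : T4Family, ∃ ζ : ResidZ F 2, B11Leaf (Z11OfRecord F 2 ζ))
    (h08 : ∀ (F : T4Family) (i : ι F), PrintedUV3V 2 (Θ F i).L)
    (h09 : ∀ (F : T4Family) (i : ι F), ∃ lam12 : ResidB12 F 2 (Θ F i).toStage13Params.τ9.M,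
      ∀ P : B12.RunParams, B12Sec2to5.Lemma4Printed (F12OfRecord₁₂ F 2 (Θ F i).toStage13Params.toStage12Params lam12 P) (lam12 P).consts)
    (h09T : ∀ (F : T4Family) (i : ι F), ∃ γ₉ : ℝ, 0 < γ₉ ∧ ∀ w : WorldP, w.C = (datumOfRecord₁₃SepCoPHAx F 2 (Θ F i) (hP F i)).C →
      w.γ ≤ γ₉ → ∀ P : B12.RunParams, (leavesP w P).smallCouplings → (leavesP w P).smallFieldInductive)
    (h10 : ∀ (F : T4Family) (i : ι F), ∃ lam13 : B12.RunParams → ResidB13 (Θ F i).toStage13Params.toStage3Params,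
      ∀ P : B12.RunParams, B13LeafOfRecord (Θ F i).toStage13Params.toStage3Params (lam13 P))
    (h11 : ∀ (F : T4Family) (i : ι F), ∀ βup β₀ : ℝ, ∃ γ₁₁ : ℝ, 0 < γ₁₁ ∧ ∀ w : WorldP, w.C = (datumOfRecord₁₃SepCoPHAx F 2 (Θ F i) (hP F i)).C →
      w.βup = βup → w.β₀ = β₀ → w.γ ≤ γ₁₁ → ∀ P : B12.RunParams, (leavesP w P).b7 → (leavesP w P).b8 → (leavesP w P).b9 → (leavesP w P).b10 → (leavesP w P).b11 →
      (leavesP w P).smallCouplings → (leavesP w P).smallFieldInductive → (leavesP w P).flowControl →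
        ∀ k, k < P.K → SLaw₁₃CoPHChi F 2 (Θ F i) (chiβOfRecord₁₃Ax F 2 (Θ F i).toStage13Params) P k → TLaw₁₃CoPHChi F 2 (Θ F i) (chiβOfRecord₁₃Ax F 2 (Θ F i).toStage13Params) P k)
    (h13 : ∀ (F : T4Family) (i : ι F), ∃ γ₁₃ : ℝ, 0 < γ₁₃ ∧ ∃ em ep : ℝ → ℝ,
        (∀ P : B12.RunParams, ((datumOfRecord₁₃SepCoPHAx F 2 (Θ F i) (hP F i)).C P).flow.InInterval γ₁₃ P.K → SLaw₁₃CoPHChi F 2 (Θ F i) (chiβOfRecord₁₃Ax F 2 (Θ F i).toStage13Params) P 0 →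
      ∀ U : GaugeField (F.P P.K) 0 (SU 2),
        chiβOfRecord₁₃Ax F 2 (Θ F i).toStage13Params P.K (gOfRecord₁₃Ax F 2 (Θ F i).toStage13Params P) 0 U *
              Real.exp (-(1 / (gOfRecord₁₃Ax F 2 (Θ F i).toStage13Params P 0) ^ 2 * wilsonBGOfRecord F 2 (Θ F i).εbg P 0 U)
                - em (gOfRecord₁₃Ax F 2 (Θ F i).toStage13Params P 0) * (Fintype.card (Site (F.P P.K) 0) : ℝ)) ≤ densOfRecord₁₃Chi F 2 (Θ F i).toStage13Params (chiβOfRecord₁₃Ax F 2 (Θ F i).toStage13Params) P 0 U ∧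
          densOfRecord₁₃Chi F 2 (Θ F i).toStage13Params (chiβOfRecord₁₃Ax F 2 (Θ F i).toStage13Params) P 0 U ≤ Real.exp (ep (gOfRecord₁₃Ax F 2 (Θ F i).toStage13Params P 0) * (Fintype.card (Site (F.P P.K) 0) : ℝ))) ∧
        (∀ P : B12.RunParams, ((datumOfRecord₁₃SepCoPHAx F 2 (Θ F i) (hP F i)).C P).flow.InInterval γ₁₃ P.K → ∀ k, k + 1 ≤ P.K → SLaw₁₃CoPHChi F 2 (Θ F i) (chiβOfRecord₁₃Ax F 2 (Θ F i).toStage13Params) P (k + 1) →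
      ∀ᵐ U ∂(fieldMeasure (F.P P.K) (k + 1) (SU 2)),
        chiβOfRecord₁₃Ax F 2 (Θ F i).toStage13Params P.K (gOfRecord₁₃Ax F 2 (Θ F i).toStage13Params P) (k + 1) U *
              Real.exp (-(1 / (gOfRecord₁₃Ax F 2 (Θ F i).toStage13Params P (k + 1)) ^ 2 * wilsonBGOfRecord F 2 (Θ F i).εbg P (k + 1) U)
                - em (gOfRecord₁₃Ax F 2 (Θ F i).toStage13Params P (k + 1)) * (Fintype.card (Site (F.P P.K) (k + 1)) : ℝ)) ≤ densOfRecord₁₃Chi F 2 (Θ F i).toStage13Params (chiβOfRecord₁₃Ax F 2 (Θ F i).toStage13Params) P (k + 1) U ∧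
          densOfRecord₁₃Chi F 2 (Θ F i).toStage13Params (chiβOfRecord₁₃Ax F 2 (Θ F i).toStage13Params) P (k + 1) U ≤ Real.exp (ep (gOfRecord₁₃Ax F 2 (Θ F i).toStage13Params P (k + 1)) * (Fintype.card (Site (F.P P.K) (k + 1)) : ℝ))))
    (hrowsR : ∀ (F : T4Family) (i : ι F), ∃ (b : ℕ → ℝ) (r γ₀ M : ℝ), 0 < γ₀ ∧
        (∀ (n : ℕ) (gs : ℕ → ℝ), RGEqH n (betaOfRecord₁₃Ax F 2 (Θ F i).toStage13Params) gs → Step.InInterval γ₀ n gs → ∀ k, k ≤ n → |betaOfRecord₁₃Ax F 2 (Θ F i).toStage13Params k (prefixOf gs k) - b k| ≤ r) ∧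
        (∀ (n : ℕ) (gs : ℕ → ℝ), RGEqH n (betaOfRecord₁₃Ax F 2 (Θ F i).toStage13Params) gs → Step.InInterval γ₀ n gs → ∀ k, k ≤ n → -M ≤ ∑ j ∈ Finset.Ico k n, betaOfRecord₁₃Ax F 2 (Θ F i).toStage13Params j (prefixOf gs j)) ∧
        ∀ k : ℕ, ContinuousOn (fun x : ℝ => betaOfRecord₁₃Ax F 2 (Θ F i).toStage13Params k (clampPrefix (betaOfRecord₁₃Ax F 2 (Θ F i).toStage13Params) γ₀ k x))
          {x : ℝ | 0 < x ∧ x ≤ γ₀ ∧ ∀ j', j' ≤ k → 1 / γ₀ ^ 2 ≤ Y (betaOfRecord₁₃Ax F 2 (Θ F i).toStage13Params) γ₀ j' x}) :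
    Summit.QuantumFields.YangMills.Theses.BalabanUVNodes.StabilityBRunRowsAtRecordR13SepCoPHVAx := by
  intro F hinh
  obtain ⟨i⟩ := hK0 F hinh
  exact N24_stabilityBRunRowsR13SepCoPHVAx_consequent_childrenSplitSlot8Thm1AE_atWitness_pinY₀_of_runRowsCont Slot8 (Θ F i) (hP F i) (hθ F i) (hU F i) (hlaws F i) (hγ₀ F i) (hbox' F i)
    (h05 F i) (Y₀ F i) (h06 F i) (h07 F) (h08 F i) (h09 F i) (h09T F i) (h10 F i) (h11 F i) (h13 F i) (hrowsR F i)

end Summit.QuantumFields.YangMills.BalabanUVNodes.N24K1R9ByNameOfOpenStubsChildrenSplitSlot8Thm1AEAtAbstractWitnessY0Chi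

end
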